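import Literature.Topology.FourManifolds.SolidTorusHandlebody
import Literature.Topology.FourManifolds.MorseBirthLemma
import Mathlib.Analysis.InnerProductSpace.Calculus
import Mathlib.LinearAlgebra.QuadraticForm.Signature
import HarnessLib

/-!
# Thickened planar domains: genus-`g` handlebodies `{q(x, y) + z² ≤ c} ⊂ ℝ³`

Topic `Literature/Topology/FourManifolds`; fact seat
`provefact-Literature.IsHandlebody.exists_diffeomorph_isOrientationReversing_boundary` (F2b₂ of
`LickorishWallaceSphereGluing.lean`, "every handlebody admits an orientation-reversing symmetry",
Juhász, *Differential and Low-Dimensional Topology* (2023), §3.5, p. 97), reduced in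
`LickorishWallaceHandlebodies.lean` to the classification UNIQ and the one-model fact SYMM
`Literature.Topology.FourManifolds.exists_isHandlebody_isOrientationReversing`: *for every `g` some genus-`g` handlebody has a
self-diffeomorphism restricting to an orientation-reversing diffeomorphism of its boundary*.
The natural models are mirror-symmetric solid bodies in `ℝ³`; this file provides the
**genus-`g` handlebody attached to a planar Morse function**, symmetric under `z ↦ -z` by
construction.  Everything here is **proved**.

Given `q : ℝ² → ℝ`, its *thickening* is `F(x, y, z) = q(x, y) + z²`
(`Literature.Topology.FourManifolds.PlanarThickening.thicken`).  Then (§3–§4, plain calculus on the model space, where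
`mfderiv = fderiv` and `Literature.Topology.FourManifolds.mhessian` is the second Fréchet derivative,
`Literature.Topology.FourManifolds.MorseBirth.mhessian_model_apply`):

* `dF_p = dq_{π p} ∘ π + 2 z dz` (`hasFDerivAt_thicken`), so the critical points of `F` are the
  points `(x, y, 0)` with `(x, y)` critical for `q` (`isMCriticalPt_thicken_iff`,
  `criticalSet_thicken`);
* `Hess F_p (v, w) = Hess q_{π p} (π v, π w) + 2 v₂ w₂` (`mhessian_thicken_apply`); hence
  nondegeneracy transfers (`nondegenerate_mhessian_thicken`, `isMorse_thicken`: **the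
  thickening of a Morse function is a Morse function on `ℝ³`**) and **the Morse index is
  unchanged** (`morseIndex_thicken`), by the signature lemma `Literature.Topology.FourManifolds.sigNeg_eq_of_proj` (§1: if
  `Q(v) ≥ Q'(π v)` with equality on a section `ι` of `π` and `Q ≥ 0` on `ker π`, then
  `sigNeg Q = sigNeg Q'` — negative definite subspaces project injectively, Sylvester);
* `Crit_i(F) ∩ {F ≤ c} = ι (Crit_i(q) ∩ {q ≤ c})` (`criticalSetOfIndex_thicken_inter`).

§5 packages the hypotheses on `q` as `Literature.IsHoledDiscMorseFunction g q c` — `q` Morse and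
coercive with finitely many critical points: one minimum (index `0`) and `g` saddles (index `1`)
below `c`, all maxima (index `2`) above `c` — and proves that then `c` is a regular level of `F`
(`IsHoledDiscMorseFunction.isRegularLevel`) and **the regular sublevel set
`{q(x, y) + z² ≤ c}` (`IsHoledDiscMorseFunction.Thickening`, an `Literature.Topology.FourManifolds.RegularSublevel`) is a
genus-`g` handlebody** (`IsHoledDiscMorseFunction.isHandlebody_thickening`: compact by
coercivity, connected by uniqueness of the minimum — Reeb's argument
`Literature.Topology.FourManifolds.RegularSublevel.connectedSpace_of_isCompact` —, orientable as a codimension-`0` submanifold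
of `ℝ³`, with the handle decomposition `Literature.Topology.FourManifolds.RegularSublevel.hasHandleDecomposition` of Milnor's
Thm. 3.1–3.2 counted by the bullet above), and records the symmetry
(`IsHoledDiscMorseFunction.exists_even_isHandlebody`).  The existence of such `q` for every `g`
(by inserting `g` saddle–maximum pairs into `‖u‖²`, Milnor 1965, Lemma 8.2) and the resulting
proof of SYMM are the sequel files.

## References

* A. Juhász, *Differential and Low-Dimensional Topology*, LMS Student Texts 104 (2023), §3.5,
  pp. 96–97 (handlebodies as thickened wedges of circles in `ℝ³`; their symmetry). [Juhasz2023]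
* J. Milnor, *Morse theory*, Ann. of Math. Studies 51 (1963), §2 (index, Sylvester's law),
  §3 (Thms. 3.1–3.2). [Milnor1963]
* J. Schultens, *Introduction to 3-Manifolds*, GSM 151 (2014), Def. 6.1.5. [Schultens2014]
-/

open scoped Manifold ContDiff Topology InnerProductSpace
open Set Function Filter Metric Module

noncomputable section

namespace Literature.Topology.FourManifolds

universe u

/-- Local notation: `𝔼 n` is the model Euclidean space `EuclideanSpace ℝ (Fin n)`. -/
local notation "𝔼 " n:arg => EuclideanSpace ℝ (Fin n)

/-! ### §1 Signature of a quadratic form split off along a projection -/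

section SigNeg

variable {V W : Type*} [AddCommGroup V] [Module ℝ V] [AddCommGroup W] [Module ℝ W]
  [Module.Finite ℝ V] [Module.Finite ℝ W]

/-- **Negative index of inertia under a split projection.** Let `π : V → W` be a linear map
with a linear section `ι` (`π ∘ ι = id`) such that `Q' (π v) ≤ Q v` for all `v`, `Q` is
nonnegative on `ker π`, and `Q ∘ ι = Q'`. Then `sigNeg Q = sigNeg Q'`: a negative definite
subspace for `Q` meets `ker π` trivially and projects onto a negative definite subspace for
`Q'`, and conversely `ι` embeds negative definite subspaces for `Q'`. (The case in point:
`Q(v) = Q'(π v) + P(v)` with `P ≥ 0` vanishing on `range ι`, e.g. the Hessian of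
`q(x, y) + z²`.) Sylvester's law of inertia, Milnor, *Morse theory* (1963), §2. [folklore] -/
theorem sigNeg_eq_of_proj (Q : QuadraticForm ℝ V) (Q' : QuadraticForm ℝ W) (π : V →ₗ[ℝ] W)
    (ι : W →ₗ[ℝ] V) (hle : ∀ v, Q' (π v) ≤ Q v) (hker : ∀ v, π v = 0 → 0 ≤ Q v)
    (hι : ∀ w, Q (ι w) = Q' w) (hπι : ∀ w, π (ι w) = w) : sigNeg Q = sigNeg Q' := by
  apply le_antisymm
  · obtain ⟨U, hU, hneg⟩ := exists_finrank_eq_sigNeg_and_negDef Q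
    set f : U →ₗ[ℝ] W := π.domRestrict U with hf
    have hinj : Function.Injective f := by
      intro u₁ u₂ h
      have h0 : f (u₁ - u₂) = 0 := by rw [map_sub, h, sub_self]
      by_contra hne
      have hne' : u₁ - u₂ ≠ 0 := sub_ne_zero.mpr hne
      have h1 : 0 < ((-Q).restrict U) (u₁ - u₂) := hneg _ hne'
      have h2 : ((-Q).restrict U) (u₁ - u₂) = -Q ((u₁ - u₂ : U) : V) := rfl
      have h3 : 0 ≤ Q ((u₁ - u₂ : U) : V) := hker _ h0
      linarith
    have hrank : Module.finrank ℝ (LinearMap.range f) = Module.finrank ℝ U :=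
      LinearMap.finrank_range_of_inj hinj
    rw [← hU, ← hrank]
    refine le_sigNeg_of_negDef Q' fun x hx => ?_
    obtain ⟨u, hu⟩ := LinearMap.mem_range.1 x.2
    have hu0 : u ≠ 0 := by
      rintro rfl
      apply hx
      exact Subtype.ext (by rw [← hu, map_zero]; rfl)
    have h1 : 0 < ((-Q).restrict U) u := hneg u hu0
    have h2 : ((-Q).restrict U) u = -Q (u : V) := rfl
    have h3 : ((-Q').restrict (LinearMap.range f)) x = -Q' (x : W) := rfl
    have h4 : (x : W) = π (u : V) := by rw [← hu]; rfl
    rw [h3, h4]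
    linarith [hle (u : V)]
  · obtain ⟨U', hU', hneg'⟩ := exists_finrank_eq_sigNeg_and_negDef Q'
    set f : U' →ₗ[ℝ] V := ι.domRestrict U' with hf
    have hinj : Function.Injective f := by
      intro w₁ w₂ h
      have h' : π (ι (w₁ : W)) = π (ι (w₂ : W)) := by
        show π (f w₁) = π (f w₂)
        rw [h]
      rw [hπι, hπι] at h'
      exact Subtype.ext h'
    have hrank : Module.finrank ℝ (LinearMap.range f) = Module.finrank ℝ U' :=
      LinearMap.finrank_range_of_inj hinj
    rw [← hU', ← hrank]
    refine le_sigNeg_of_negDef Q fun x hx => ?_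
    obtain ⟨w, hw⟩ := LinearMap.mem_range.1 x.2
    have hw0 : w ≠ 0 := by
      rintro rfl
      apply hx
      exact Subtype.ext (by rw [← hw, map_zero]; rfl)
    have h1 : 0 < ((-Q').restrict U') w := hneg' w hw0
    have h2 : ((-Q').restrict U') w = -Q' (w : W) := rfl
    have h3 : ((-Q).restrict (LinearMap.range f)) x = -Q (x : V) := rfl
    have h4 : (x : V) = ι (w : W) := by rw [← hw]; rfl
    rw [h3, h4, hι]
    linarith

end SigNeg

/-! ### §2 The projection `ℝ³ → ℝ²`, the lift `ℝ² → ℝ³` and the thickening `q(x, y) + z²` -/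

namespace PlanarThickening

/-- The projection `π(x, y, z) = (x, y)` as a continuous linear map `ℝ³ → ℝ²`. [folklore] -/
def proj : 𝔼 3 →L[ℝ] 𝔼 2 :=
  LinearMap.toContinuousLinearMap
    { toFun := fun p => WithLp.toLp 2 ![p 0, p 1]
      map_add' := fun p p' => by ext i; fin_cases i <;> simp
      map_smul' := fun a p => by ext i; fin_cases i <;> simp }

/-- `(π p)₀ = p₀`. [folklore] -/
@[simp] theorem proj_apply_zero (p : 𝔼 3) : proj p 0 = p 0 := rfl

/-- `(π p)₁ = p₁`. [folklore] -/
@[simp] theorem proj_apply_one (p : 𝔼 3) : proj p 1 = p 1 := rfl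

/-- The lift `ι(x, y) = (x, y, 0)` as a continuous linear map `ℝ² → ℝ³`. [folklore] -/
def lift : 𝔼 2 →L[ℝ] 𝔼 3 :=
  LinearMap.toContinuousLinearMap
    { toFun := fun u => WithLp.toLp 2 ![u 0, u 1, 0]
      map_add' := fun u u' => by ext i; fin_cases i <;> simp
      map_smul' := fun a u => by ext i; fin_cases i <;> simp }

/-- `(ι u)₀ = u₀`. [folklore] -/
@[simp] theorem lift_apply_zero (u : 𝔼 2) : lift u 0 = u 0 := rfl

/-- `(ι u)₁ = u₁`. [folklore] -/
@[simp] theorem lift_apply_one (u : 𝔼 2) : lift u 1 = u 1 := rfl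

/-- `(ι u)₂ = 0`. [folklore] -/
@[simp] theorem lift_apply_two (u : 𝔼 2) : lift u 2 = 0 := rfl

/-- `π ∘ ι = id`. [folklore] -/
@[simp] theorem proj_lift (u : 𝔼 2) : proj (lift u) = u := by
  ext i; fin_cases i <;> rfl

/-- The third basis vector `e₂ = (0, 0, 1)`. [folklore] -/
def ez : 𝔼 3 := WithLp.toLp 2 ![0, 0, 1]

/-- `(e₂)₀ = 0`. [folklore] -/
@[simp] theorem ez_apply_zero : ez 0 = 0 := rfl

/-- `(e₂)₁ = 0`. [folklore] -/
@[simp] theorem ez_apply_one : ez 1 = 0 := rfl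

/-- `(e₂)₂ = 1`. [folklore] -/
@[simp] theorem ez_apply_two : ez 2 = 1 := rfl

/-- `π e₂ = 0`. [folklore] -/
@[simp] theorem proj_ez : proj ez = 0 := by
  ext i; fin_cases i <;> rfl

/-- Decomposition `p = ι (π p) + p₂ e₂`. [folklore] -/
theorem lift_proj_add (p : 𝔼 3) : lift (proj p) + p 2 • ez = p := by
  ext i; fin_cases i <;> simp

/-- `p = ι (π p)` iff `p₂ = 0`. [folklore] -/
theorem eq_lift_proj_iff (p : 𝔼 3) : p = lift (proj p) ↔ p 2 = 0 := by
  constructor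
  · intro h
    have := congrArg (fun v : 𝔼 3 => v 2) h
    simpa using this
  · intro h
    ext i; fin_cases i
    · rfl
    · rfl
    · simpa using h

/-- `ι` is injective. [folklore] -/
theorem lift_injective : Injective lift := fun u u' h => by
  rw [← proj_lift u, ← proj_lift u', h]

/-- `‖p‖² = ‖π p‖² + p₂²`. [folklore] -/
theorem norm_sq_eq (p : 𝔼 3) : ‖p‖ ^ 2 = ‖proj p‖ ^ 2 + p 2 ^ 2 := by
  rw [EuclideanSpace.norm_sq_eq, EuclideanSpace.norm_sq_eq, Fin.sum_univ_three, Fin.sum_univ_two]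
  simp [Real.norm_eq_abs, sq_abs]

/-- The third coordinate functional `dz : p ↦ p₂`. [folklore] -/
abbrev zc : 𝔼 3 →L[ℝ] ℝ := EuclideanSpace.proj (2 : Fin 3)

/-- `dz p = p₂` (definitional). [folklore] -/
@[simp] theorem zc_apply (p : 𝔼 3) : zc p = p 2 := rfl

/-- **The thickening** `F(x, y, z) = q(x, y) + z²` of a planar function `q`. [folklore] -/
def thicken (q : 𝔼 2 → ℝ) (p : 𝔼 3) : ℝ := q (proj p) + p 2 ^ 2

variable {q : 𝔼 2 → ℝ}

/-- Unfolding of the thickening. [folklore] -/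
theorem thicken_apply (q : 𝔼 2 → ℝ) (p : 𝔼 3) : thicken q p = q (proj p) + p 2 ^ 2 := rfl

/-- `F(x, y, 0) = q(x, y)`. [folklore] -/
@[simp] theorem thicken_lift (q : 𝔼 2 → ℝ) (u : 𝔼 2) : thicken q (lift u) = q u := by
  simp [thicken]

/-- `q(π p) ≤ F(p)`. [folklore] -/
theorem le_thicken (q : 𝔼 2 → ℝ) (p : 𝔼 3) : q (proj p) ≤ thicken q p := by
  rw [thicken_apply]; nlinarith [sq_nonneg (p 2)]

/-! ### §3 First and second derivatives of the thickening -/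

/-- `p ↦ p₂²` has derivative `2 p₂ dz`. [folklore] -/
theorem hasFDerivAt_zsq (p : 𝔼 3) :
    HasFDerivAt (fun p : 𝔼 3 => p 2 ^ 2) ((2 * p 2) • (zc : 𝔼 3 →L[ℝ] ℝ)) p := by
  have h : HasFDerivAt (fun p : 𝔼 3 => (zc : 𝔼 3 →L[ℝ] ℝ) p ^ 2) _ p :=
    (zc.hasFDerivAt (x := p)).pow 2
  refine h.congr_fderiv ?_
  ext v
  simp

/-- Chain rule for the planar part. [folklore] -/
theorem hasFDerivAt_comp_proj {q' : 𝔼 2 →L[ℝ] ℝ} {p : 𝔼 3} (hq : HasFDerivAt q q' (proj p)) :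
    HasFDerivAt (fun p : 𝔼 3 => q (proj p)) (q'.comp proj) p :=
  hq.comp p proj.hasFDerivAt

/-- **First derivative of the thickening**: `dF_p = dq_{π p} ∘ π + 2 p₂ dz`. [folklore] -/
theorem hasFDerivAt_thicken {q' : 𝔼 2 →L[ℝ] ℝ} {p : 𝔼 3} (hq : HasFDerivAt q q' (proj p)) :
    HasFDerivAt (thicken q) (q'.comp proj + (2 * p 2) • (zc : 𝔼 3 →L[ℝ] ℝ)) p :=
  (hasFDerivAt_comp_proj hq).add (hasFDerivAt_zsq p)

/-- `fderiv` of the thickening. [folklore] -/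
theorem fderiv_thicken (hq : Differentiable ℝ q) (p : 𝔼 3) :
    fderiv ℝ (thicken q) p = (fderiv ℝ q (proj p)).comp proj + (2 * p 2) • (zc : 𝔼 3 →L[ℝ] ℝ) :=
  (hasFDerivAt_thicken (hq (proj p)).hasFDerivAt).fderiv

/-- The thickening of a `C^n` function is `C^n`. [folklore] -/
theorem contDiff_thicken {n : WithTop ℕ∞} (hq : ContDiff ℝ n q) : ContDiff ℝ n (thicken q) :=
  (hq.comp proj.contDiff).add ((zc.contDiff).pow 2)

/-- **The derivative of the thickening vanishes iff `dq_{π p} = 0` and `p₂ = 0`.** [folklore] -/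
theorem fderiv_thicken_eq_zero_iff (hq : Differentiable ℝ q) (p : 𝔼 3) :
    fderiv ℝ (thicken q) p = 0 ↔ fderiv ℝ q (proj p) = 0 ∧ p 2 = 0 := by
  rw [fderiv_thicken hq]
  constructor
  · intro h
    have hz : p 2 = 0 := by
      have := congrArg (fun L : 𝔼 3 →L[ℝ] ℝ => L ez) h
      simp only [add_apply, ContinuousLinearMap.comp_apply, proj_ez, map_zero,
        FunLike.coe_smul, Pi.smul_apply, zc_apply, ez_apply_two, smul_eq_mul, mul_one,
        zero_add, zero_apply] at this
      linarith
    refine ⟨?_, hz⟩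
    refine ContinuousLinearMap.ext fun u => ?_
    have := congrArg (fun L : 𝔼 3 →L[ℝ] ℝ => L (lift u)) h
    simpa [hz] using this
  · rintro ⟨h1, h2⟩
    rw [h1, h2]; simp

/-- **Second derivative of the thickening**: if `fderiv q` has derivative `q''` at `π p`, then
`fderiv (thicken q)` has derivative `v ↦ q'' (π v) ∘ π + 2 v₂ dz` at `p`. [folklore] -/
theorem hasFDerivAt_fderiv_thicken (hq : Differentiable ℝ q) {q'' : 𝔼 2 →L[ℝ] 𝔼 2 →L[ℝ] ℝ}
    {p : 𝔼 3} (hq2 : HasFDerivAt (fderiv ℝ q) q'' (proj p)) :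
    HasFDerivAt (fderiv ℝ (thicken q))
      ((ContinuousLinearMap.precomp ℝ proj).comp (q''.comp proj) +
        (2 : ℝ) • (ContinuousLinearMap.smulRightL ℝ (𝔼 3) ℝ zc).comp zc) p := by
  have h1 : HasFDerivAt (fun p : 𝔼 3 => (fderiv ℝ q (proj p)).comp proj)
      ((ContinuousLinearMap.precomp ℝ proj).comp (q''.comp proj)) p := by
    have hc : HasFDerivAt (fun p : 𝔼 3 => fderiv ℝ q (proj p)) (q''.comp proj) p :=
      hq2.comp p proj.hasFDerivAt
    exact (ContinuousLinearMap.precomp ℝ proj).hasFDerivAt.comp p hc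
  have h2 : HasFDerivAt (fun p : 𝔼 3 => (2 * p 2) • (zc : 𝔼 3 →L[ℝ] ℝ))
      ((2 : ℝ) • (ContinuousLinearMap.smulRightL ℝ (𝔼 3) ℝ zc).comp zc) p := by
    have hs : HasFDerivAt (fun p : 𝔼 3 => 2 * p 2) ((2 : ℝ) • (zc : 𝔼 3 →L[ℝ] ℝ)) p := by
      have := (zc.hasFDerivAt (x := p)).const_mul (2 : ℝ)
      simpa using this
    refine (hs.smul_const (zc : 𝔼 3 →L[ℝ] ℝ)).congr_fderiv ?_
    ext v w
    simp [ContinuousLinearMap.smulRightL, ContinuousLinearMap.smulRight_apply]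
    ring
  have h := h1.add h2
  refine h.congr_of_eventuallyEq (Eventually.of_forall fun p' => ?_)
  simp only [Pi.add_apply]
  exact fderiv_thicken hq p'

/-- **The Hessian of the thickening, evaluated**: for `q` of class `C²`,
`D²F_p(v, w) = D²q_{π p}(π v, π w) + 2 v₂ w₂`. [folklore] -/
theorem fderiv_fderiv_thicken_apply (hq : ContDiff ℝ 2 q) (p v w : 𝔼 3) :
    fderiv ℝ (fderiv ℝ (thicken q)) p v w =
      fderiv ℝ (fderiv ℝ q) (proj p) (proj v) (proj w) + 2 * v 2 * w 2 := by
  have hd : Differentiable ℝ q := hq.differentiable (by norm_num)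
  have hd2 : DifferentiableAt ℝ (fderiv ℝ q) (proj p) := by
    have : ContDiff ℝ 1 (fderiv ℝ q) := hq.fderiv_right (by norm_num)
    exact (this.differentiable (by norm_num)) _
  rw [(hasFDerivAt_fderiv_thicken hd hd2.hasFDerivAt).fderiv]
  simp [ContinuousLinearMap.smulRightL, ContinuousLinearMap.smulRight_apply,
    ContinuousLinearMap.precomp]
  ring

/-! ### §4 Morse data of the thickening -/

/-- A Morse function on the model plane is smooth. [folklore] -/
theorem contDiff_of_isMorse (hq : IsMorse (𝓡 2) q) : ContDiff ℝ ∞ q :=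
  contMDiff_iff_contDiff.1 hq.1

/-- **Critical points of the thickening**: `p` is critical for `F = q ∘ π + z²` iff `π p` is
critical for `q` and `p₂ = 0`. [folklore] -/
theorem isMCriticalPt_thicken_iff (hq : Differentiable ℝ q) (p : 𝔼 3) :
    IsMCriticalPt (𝓡 3) (thicken q) p ↔ IsMCriticalPt (𝓡 2) q (proj p) ∧ p 2 = 0 := by
  rw [MorseBirth.isMCriticalPt_iff_fderiv, MorseBirth.isMCriticalPt_iff_fderiv,
    fderiv_thicken_eq_zero_iff hq]

/-- The critical points of the thickening are the lifts `(x, y, 0)` of the critical points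
`(x, y)` of `q`. [folklore] -/
theorem isMCriticalPt_thicken_iff' (hq : Differentiable ℝ q) (p : 𝔼 3) :
    IsMCriticalPt (𝓡 3) (thicken q) p ↔ ∃ u, IsMCriticalPt (𝓡 2) q u ∧ p = lift u := by
  rw [isMCriticalPt_thicken_iff hq]
  constructor
  · rintro ⟨h1, h2⟩
    exact ⟨proj p, h1, (eq_lift_proj_iff p).2 h2⟩
  · rintro ⟨u, hu, rfl⟩
    exact ⟨by simpa using hu, rfl⟩

/-- `crit F = ι (crit q)`. [folklore] -/
theorem criticalSet_thicken (hq : Differentiable ℝ q) :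
    criticalSet (𝓡 3) (thicken q) = lift '' criticalSet (𝓡 2) q := by
  ext p
  simp only [mem_criticalSet, isMCriticalPt_thicken_iff' hq, mem_image]
  constructor
  · rintro ⟨u, hu, rfl⟩; exact ⟨u, hu, rfl⟩
  · rintro ⟨u, hu, rfl⟩; exact ⟨u, hu, rfl⟩

/-- **The Hessian of the thickening**: `Hess F_p (v, w) = Hess q_{π p} (π v, π w) + 2 v₂ w₂`
(on the model vector space the Hessian of `Literature.Topology.FourManifolds.mhessian` is the second Fréchet derivative,
`Literature.Topology.FourManifolds.MorseBirth.mhessian_model_apply`). [folklore] -/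
theorem mhessian_thicken_apply (hq : ContDiff ℝ 2 q) (p v w : 𝔼 3) :
    mhessian (𝓡 3) (thicken q) p v w =
      mhessian (𝓡 2) q (proj p) (proj v) (proj w) + 2 * v 2 * w 2 := by
  rw [MorseBirth.mhessian_model_apply, MorseBirth.mhessian_model_apply,
    fderiv_fderiv_thicken_apply hq]

/-- **Nondegeneracy transfers to the thickening**: if `Hess q_{π p}` is nondegenerate, so is
`Hess F_p`. [folklore] -/
theorem nondegenerate_mhessian_thicken (hq : ContDiff ℝ 2 q) {p : 𝔼 3}
    (h : (mhessian (𝓡 2) q (proj p)).Nondegenerate) :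
    (mhessian (𝓡 3) (thicken q) p).Nondegenerate := by
  have key : ∀ v : 𝔼 3, (∀ u : 𝔼 2, mhessian (𝓡 2) q (proj p) (proj v) u = 0 ∧
      mhessian (𝓡 2) q (proj p) u (proj v) = 0) → v 2 = 0 → v = 0 := by
    intro v hv hz
    have hπ : proj v = 0 := h.1 (proj v) fun u => (hv u).1
    rw [← lift_proj_add v, hπ, hz]; simp
  refine ⟨fun v hv => ?_, fun v hv => ?_⟩
  · have hz : v 2 = 0 := by
      have h1 := hv ez
      rw [mhessian_thicken_apply hq] at h1
      simp only [proj_ez, map_zero, ez_apply_two, mul_one, zero_add] at h1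
      linarith
    refine key v (fun u => ⟨?_, ?_⟩) hz
    · have h1 := hv (lift u)
      rw [mhessian_thicken_apply hq] at h1
      simpa [hz] using h1
    · -- not needed for the left kernel, but `key` asks for both; derive from symmetry-free data:
      -- use nondegeneracy on the right applied to the functional `u ↦ B (π v) u`
      have hπ : proj v = 0 := h.1 (proj v) fun u => by
        have h1 := hv (lift u)
        rw [mhessian_thicken_apply hq] at h1
        simpa [hz] using h1
      simp [hπ]
  · have hz : v 2 = 0 := by
      have h1 := hv ez
      rw [mhessian_thicken_apply hq] at h1
      simp only [proj_ez, map_zero, LinearMap.zero_apply, ez_apply_two, mul_one, zero_add] at h1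
      linarith
    have hπ : proj v = 0 := h.2 (proj v) fun u => by
      have h1 := hv (lift u)
      rw [mhessian_thicken_apply hq] at h1
      simpa [hz] using h1
    rw [← lift_proj_add v, hπ, hz]; simp

/-- **The thickening of a planar Morse function is a Morse function on `ℝ³`.** [folklore] -/
theorem isMorse_thicken (hq : IsMorse (𝓡 2) q) : IsMorse (𝓡 3) (thicken q) := by
  have hs : ContDiff ℝ ∞ q := contDiff_of_isMorse hq
  have hd : Differentiable ℝ q := hs.differentiable (by simp)
  refine ⟨contMDiff_iff_contDiff.2 (contDiff_thicken hs), fun p hp => ?_⟩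
  rw [isMCriticalPt_thicken_iff hd] at hp
  exact nondegenerate_mhessian_thicken (hs.of_le (by norm_cast)) (hq.2 _ hp.1)

/-- **The Morse index is unchanged by thickening**: `index_F (p) = index_q (π p)` (the Hessian
of `F` is that of `q` plus the positive square `2 z²` split off along `π`,
`Literature.Topology.FourManifolds.sigNeg_eq_of_proj`). Milnor, *Morse theory* (1963), §2. [cite: Milnor1963, §2] -/
theorem morseIndex_thicken (hq : ContDiff ℝ 2 q) (p : 𝔼 3) :
    morseIndex (𝓡 3) (thicken q) p = morseIndex (𝓡 2) q (proj p) := by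
  unfold morseIndex
  refine sigNeg_eq_of_proj _ _ (proj : 𝔼 3 →L[ℝ] 𝔼 2).toLinearMap
    (lift : 𝔼 2 →L[ℝ] 𝔼 3).toLinearMap (fun v => ?_) (fun v hv => ?_) (fun w => ?_) (fun w => ?_)
  · simp only [LinearMap.BilinMap.toQuadraticMap_apply, ContinuousLinearMap.coe_coe,
      mhessian_thicken_apply hq]
    nlinarith [sq_nonneg (v 2)]
  · simp only [ContinuousLinearMap.coe_coe] at hv
    simp only [LinearMap.BilinMap.toQuadraticMap_apply, mhessian_thicken_apply hq, hv, map_zero,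
      zero_add]
    nlinarith [sq_nonneg (v 2)]
  · simp [LinearMap.BilinMap.toQuadraticMap_apply, mhessian_thicken_apply hq]
  · simp

/-- `Crit_i(F) = ι (Crit_i(q))` for every index `i`. [folklore] -/
theorem criticalSetOfIndex_thicken (hq : ContDiff ℝ 2 q) (i : ℕ) :
    criticalSetOfIndex (𝓡 3) (thicken q) i = lift '' criticalSetOfIndex (𝓡 2) q i := by
  have hd : Differentiable ℝ q := hq.differentiable (by norm_num)
  ext p
  simp only [mem_criticalSetOfIndex, mem_image, isMCriticalPt_thicken_iff' hd]
  constructor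
  · rintro ⟨⟨u, hu, rfl⟩, hi⟩
    refine ⟨u, ⟨hu, ?_⟩, rfl⟩
    rwa [morseIndex_thicken hq, proj_lift] at hi
  · rintro ⟨u, ⟨hu, hi⟩, rfl⟩
    refine ⟨⟨u, hu, rfl⟩, ?_⟩
    rwa [morseIndex_thicken hq, proj_lift]

/-- Critical points of index `i` below the level `c` correspond under `ι`. [folklore] -/
theorem criticalSetOfIndex_thicken_inter (hq : ContDiff ℝ 2 q) (i : ℕ) (c : ℝ) :
    criticalSetOfIndex (𝓡 3) (thicken q) i ∩ thicken q ⁻¹' Iic c =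
      lift '' (criticalSetOfIndex (𝓡 2) q i ∩ q ⁻¹' Iic c) := by
  rw [criticalSetOfIndex_thicken hq]
  ext p
  simp only [mem_inter_iff, mem_preimage, mem_Iic, mem_image]
  constructor
  · rintro ⟨⟨u, hu, rfl⟩, hc⟩
    exact ⟨u, ⟨hu, by simpa using hc⟩, rfl⟩
  · rintro ⟨u, ⟨hu, hc⟩, rfl⟩
    exact ⟨⟨u, hu, rfl⟩, by simpa using hc⟩

end PlanarThickening

/-! ### §5 Planar Morse functions presenting a disc with `g` holes, and their thickenings -/

open PlanarThickening

/-- **A planar Morse function presenting a disc with `g` holes below the level `c`.** The data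
from which the thickening `{q(x, y) + z² ≤ c} ⊂ ℝ³` is a genus-`g` handlebody: `q : ℝ² → ℝ` is
a Morse function, coercive (`‖u‖² ≤ q u + B`), with finitely many critical points, exactly one of
index `0` and it lies below `c`, exactly `g` of index `1`, all below `c`, and all critical points
of index `2` above `c` (so `c` is a regular value and `{q ≤ c}` is a disc with `g` holes, each
hole containing a maximum). For the standard embedding `♮^g (S¹ × D²) ⊂ ℝ³` as a thickened
planar domain see Juhász (2023), §3.5, p. 96 ("a regular neighbourhood of a wedge of `g`
unknotted circles in `ℝ³`"). [cite: Juhasz2023, §3.5 (p. 96)] -/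
structure IsHoledDiscMorseFunction (g : ℕ) (q : 𝔼 2 → ℝ) (c : ℝ) : Prop where
  /-- `q` is a Morse function on the plane. -/
  isMorse : IsMorse (𝓡 2) q
  /-- `q` is coercive: `‖u‖² ≤ q u + B`. -/
  exists_bound : ∃ B : ℝ, ∀ u, ‖u‖ ^ 2 ≤ q u + B
  /-- `q` has finitely many critical points. -/
  finite_criticalSet : (criticalSet (𝓡 2) q).Finite
  /-- Exactly one critical point of index `0`, below `c`. -/
  exists_index_zero : ∃ u₀, criticalSetOfIndex (𝓡 2) q 0 = {u₀} ∧ q u₀ < c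
  /-- Exactly `g` critical points of index `1`. -/
  ncard_index_one : (criticalSetOfIndex (𝓡 2) q 1).ncard = g
  /-- The saddles lie below `c`. -/
  lt_of_index_one : ∀ u ∈ criticalSetOfIndex (𝓡 2) q 1, q u < c
  /-- The maxima lie above `c`. -/
  lt_of_index_two : ∀ u ∈ criticalSetOfIndex (𝓡 2) q 2, c < q u

namespace IsHoledDiscMorseFunction

variable {g : ℕ} {q : 𝔼 2 → ℝ} {c : ℝ} (h : IsHoledDiscMorseFunction g q c)
include h

omit h in
/-- The Morse index on the plane is `≤ 2`. [cite: Milnor1963, §2] -/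
theorem morseIndex_le_two (u : 𝔼 2) : morseIndex (𝓡 2) q u ≤ 2 := by
  have := morseIndex_le_finrank (𝓡 2) q u
  rwa [finrank_euclideanSpace_fin] at this

/-- No critical value equals `c`. [folklore] -/
theorem apply_ne_of_isMCriticalPt {u : 𝔼 2} (hu : IsMCriticalPt (𝓡 2) q u) : q u ≠ c := by
  have hle := morseIndex_le_two (q := q) u
  rcases Nat.lt_or_ge (morseIndex (𝓡 2) q u) 3 with hi | hi
  · interval_cases hm : morseIndex (𝓡 2) q u
    · obtain ⟨u₀, h0, hc⟩ := h.exists_index_zero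
      have : u ∈ criticalSetOfIndex (𝓡 2) q 0 := ⟨hu, hm⟩
      rw [h0, mem_singleton_iff] at this
      rw [this]; exact hc.ne
    · exact (h.lt_of_index_one u ⟨hu, hm⟩).ne
    · exact (h.lt_of_index_two u ⟨hu, hm⟩).ne'
  · omega

omit h in
/-- Critical sets of index `≥ 3` are empty in the plane. [cite: Milnor1963, §2] -/
theorem criticalSetOfIndex_eq_empty {i : ℕ} (hi : 3 ≤ i) : criticalSetOfIndex (𝓡 2) q i = ∅ :=
  eq_empty_of_forall_notMem fun u hu => by
    have := morseIndex_le_two (q := q) u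
    rw [hu.2] at this
    omega

/-- **`c` is a regular level of the thickening `F = q ∘ π + z²`.** [folklore] -/
theorem isRegularLevel : IsRegularLevel (𝓡 3) (thicken q) c := by
  have hd : Differentiable ℝ q := (contDiff_of_isMorse h.isMorse).differentiable (by simp)
  refine (isMorse_thicken h.isMorse).isRegularLevel fun z hz => ?_
  obtain ⟨u, hu, rfl⟩ := (isMCriticalPt_thicken_iff' hd z).1 hz
  rw [thicken_lift]
  exact h.apply_ne_of_isMCriticalPt hu

/-- **The thickened planar domain** `H = {q(x, y) + z² ≤ c} ⊂ ℝ³`, a regular sublevel set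
(`Literature.Topology.FourManifolds.RegularSublevel`: a smooth `3`-manifold with boundary the level surface
`{q(x, y) + z² = c}`). [folklore] -/
abbrev Thickening : Type := RegularSublevel h.isRegularLevel

/-- A priori bound: `‖p‖² ≤ c + B` on `{F ≤ c}`. [folklore] -/
theorem norm_sq_le_of_thicken_le : ∃ B : ℝ, ∀ p : 𝔼 3, thicken q p ≤ c → ‖p‖ ^ 2 ≤ c + B := by
  obtain ⟨B, hB⟩ := h.exists_bound
  refine ⟨B, fun p hp => ?_⟩
  rw [norm_sq_eq]
  have := hB (proj p)
  rw [thicken_apply] at hp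
  linarith

/-- **`{F ≤ c}` is compact** (closed and bounded). [folklore] -/
theorem isCompact_preimage : IsCompact (thicken q ⁻¹' Iic c) := by
  obtain ⟨B, hB⟩ := h.norm_sq_le_of_thicken_le
  have hcont : Continuous (thicken q) := (contDiff_thicken (contDiff_of_isMorse h.isMorse)).continuous
  refine Metric.isCompact_of_isClosed_isBounded (isClosed_Iic.preimage hcont) ?_
  rw [isBounded_iff_forall_norm_le]
  refine ⟨|c + B| + 1, fun p hp => ?_⟩
  have h1 : ‖p‖ ^ 2 ≤ c + B := hB p hp
  nlinarith [norm_nonneg p, abs_nonneg (c + B), le_abs_self (c + B), sq_nonneg (‖p‖ - 1)]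

/-- `{F ≤ c}` is compact. [folklore] -/
instance : CompactSpace h.Thickening :=
  RegularSublevel.compactSpace_of_isCompact _ h.isCompact_preimage

/-- The handle count of `{F ≤ c}`: one critical point of index `0` and `g` of index `1` below
`c`, none of index `2` below `c`, none of higher index. [folklore] -/
theorem ncard_criticalSetOfIndex_inter (i : ℕ) :
    (criticalSetOfIndex (𝓡 3) (thicken q) i ∩ thicken q ⁻¹' Iic c).ncard = handleCount 1 g i := by
  have hs : ContDiff ℝ 2 q := (contDiff_of_isMorse h.isMorse).of_le (by norm_cast)
  rw [criticalSetOfIndex_thicken_inter hs, ncard_image_of_injective _ lift_injective]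
  rcases Nat.lt_or_ge i 3 with hi | hi
  · interval_cases i
    · obtain ⟨u₀, h0, hc⟩ := h.exists_index_zero
      rw [h0, handleCount_zero]
      have : ({u₀} : Set (𝔼 2)) ∩ q ⁻¹' Iic c = {u₀} :=
        inter_eq_left.2 (singleton_subset_iff.2 hc.le)
      rw [this, ncard_singleton]
    · have : criticalSetOfIndex (𝓡 2) q 1 ∩ q ⁻¹' Iic c = criticalSetOfIndex (𝓡 2) q 1 :=
        inter_eq_left.2 fun u hu => (h.lt_of_index_one u hu).le
      rw [handleCount_one, this, h.ncard_index_one]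
    · rw [handleCount_of_two_le _ _ le_rfl]
      have : criticalSetOfIndex (𝓡 2) q 2 ∩ q ⁻¹' Iic c = ∅ :=
        eq_empty_of_forall_notMem fun u hu => absurd hu.2 (not_le.2 (h.lt_of_index_two u hu.1))
      rw [this, ncard_empty]
  · rw [criticalSetOfIndex_eq_empty (q := q) hi, empty_inter, ncard_empty,
      handleCount_of_two_le _ _ (by omega)]

/-- `{F ≤ c}` is connected: one critical point of index `0` (Reeb's argument,
`Literature.Topology.FourManifolds.RegularSublevel.connectedSpace_of_isCompact`). [cite: Milnor1963, §3 and proof of Thm. 4.1] -/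
instance : ConnectedSpace h.Thickening := by
  have hs : ContDiff ℝ 2 q := (contDiff_of_isMorse h.isMorse).of_le (by norm_cast)
  obtain ⟨u₀, h0, hc⟩ := h.exists_index_zero
  refine RegularSublevel.connectedSpace_of_isCompact _ h.isCompact_preimage ?_
    ⟨lift u₀, by rw [thicken_lift]; exact hc.le⟩
  rw [criticalSetOfIndex_thicken hs, h0, image_singleton]
  exact subsingleton_singleton

/-- `{F ≤ c}` is orientable (a codimension-`0` submanifold of `ℝ³`). [folklore] -/
theorem isOrientable_thickening : IsOrientable (𝓡∂ 3) h.Thickening :=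
  RegularSublevel.isOrientable _ (isOrientable_euclideanSpace 3)

/-- **`{F ≤ c}` has a handle decomposition with one `0`-handle and `g` `1`-handles** (the
adapted Morse function `F|{F ≤ c} + (1 - c)`, `Literature.Topology.FourManifolds.RegularSublevel.hasHandleDecomposition`).
[cite: Milnor1963, Thms. 3.1–3.2] -/
theorem hasHandleDecomposition_thickening :
    HasHandleDecomposition 2 h.Thickening (handleCount 1 g) := by
  have hd := RegularSublevel.hasHandleDecomposition (isMorse_thicken h.isMorse) h.isRegularLevel
  have hfun : (fun i => (criticalSetOfIndex (𝓡 3) (thicken q) i ∩ thicken q ⁻¹' Iic c).ncard) =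
      handleCount 1 g := funext h.ncard_criticalSetOfIndex_inter
  rw [hfun] at hd
  exact hd

/-- **The thickening `{q(x, y) + z² ≤ c} ⊂ ℝ³` of a planar Morse function presenting a disc
with `g` holes is a genus-`g` handlebody** (`Literature.IsHandlebody g`: compact, connected,
orientable, one `0`-handle and `g` `1`-handles). Juhász (2023), §3.5, p. 96: a genus-`g`
handlebody is "a three-ball with `g` one-handles attached … alternatively, a regular
neighbourhood of a wedge of `g` unknotted circles in `ℝ³`"; Schultens (2014), Def. 6.1.5.
[cite: Juhasz2023, §3.5 (p. 96)] -/
theorem isHandlebody_thickening : IsHandlebody g h.Thickening :=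
  ⟨inferInstance, inferInstance, h.isOrientable_thickening, h.hasHandleDecomposition_thickening⟩

end IsHoledDiscMorseFunction

/-- **Genus-`g` handlebodies in `ℝ³` from planar Morse functions, symmetric under `z ↦ -z`.**
If a planar Morse function presents a disc with `g` holes below `c`, then there are a smooth
`F : ℝ³ → ℝ` with `F(x, y, -z) = F(x, y, z)` (namely `F = q(x, y) + z²`) and a regular level `c`
of `F` with `{F ≤ c}` a genus-`g` handlebody — the input of the mirror-symmetry mechanism for the
fact `Literature.Topology.FourManifolds.exists_isHandlebody_isOrientationReversing` (SYMM). [cite: Juhasz2023, §3.5 (pp. 96–97)] -/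
theorem IsHoledDiscMorseFunction.exists_even_isHandlebody {g : ℕ} {q : 𝔼 2 → ℝ} {c : ℝ}
    (h : IsHoledDiscMorseFunction g q c) :
    ∃ (F : 𝔼 3 → ℝ) (c : ℝ) (hF : IsRegularLevel (𝓡 3) F c),
      (∀ p : 𝔼 3, ∀ p' : 𝔼 3, p' 0 = p 0 → p' 1 = p 1 → p' 2 = -p 2 → F p' = F p) ∧
        IsHandlebody g (RegularSublevel hF) := by
  refine ⟨thicken q, c, h.isRegularLevel, fun p p' h0 h1 h2 => ?_, h.isHandlebody_thickening⟩
  simp only [thicken_apply]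
  have hp : proj p' = proj p := by
    ext i; fin_cases i
    · exact h0
    · exact h1
  rw [hp, h2, neg_sq]



end Literature.Topology.FourManifolds
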